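import Literature.MathematicalPhysics.QuantumManyBody.WeightedCorrector
import HarnessLib

/-!
# Thomson's principle for the weighted `H₋₁` norm on the `N`-particle torus

Topic `Literature/MathematicalPhysics/QuantumManyBody` (companion of `WeightedCorrector.lean`:
`dirichletFormW`, `hMinusOneSqW`, `IsPeriodicTest`, `pderiv`, `gradDot`).

**Thomson's (Kelvin's) principle**, flux side [LyonsPeres2016, §2.4; DoyleSnell2000, §1.3.5]: the
energy of *any* flow with prescribed sources bounds the effective resistance from above, with equality
for the current flow. In the continuum dictionary of the weighted Dirichlet form
`𝓔_F(φ) = ∫_{[0,L)^{3N}} |∇φ|² F² dX` (conductivity `F²`, Kipnis–Varadhan `H₋₁` norm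
`‖g‖²₋₁ = sup_φ {2∫ g φ F² − 𝓔_F(φ)}`, [KipnisLandim1999, App. 1 §6 (6.1)]): if a flux
`J = (J_{i,k})` transports the charge `g F²` weakly on the torus,
`∫ g φ F² dX = −∫ (J·∇φ) F² dX` for every periodic test function `φ`, then

  `‖g‖²₋₁ ≤ ∫ |J|² F² dX`                                   (`hMinusOneSqW_le_of_flux`),

by one Cauchy–Schwarz inequality: `2∫ g φ F² − 𝓔_F(φ) = −2∫ (J·∇φ)F² − ∫ |∇φ|²F² ≤ ∫ |J|²F²`.
Configuration space gives every particle its own three directions, so the Dirichlet form is the SUM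
of the fibre forms `𝓔_F^{(i)}(φ) = ∫ |∇ᵢφ|² F²` and fibre bounds add with no cross terms:

* `hMinusOneSqW_sum_le_of_fibre` — if `(∫ θᵢ φ F²)² ≤ cᵢ 𝓔_F^{(i)}(φ)` for every test `φ` and every
  particle `i`, then `‖∑ᵢ θᵢ‖²₋₁ ≤ ∑ᵢ cᵢ` (Cauchy–Schwarz over the particles);
* `hMinusOneSqW_le_of_fibreFlux` — fibre fluxes `Jᵢ = (J_{i,k})_k` transporting `θᵢ F²` along the
  directions of particle `i` only, with energies `∫ |Jᵢ|² F² ≤ cᵢ`, give `‖∑ᵢ θᵢ‖²₋₁ ≤ ∑ᵢ cᵢ`.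

All statements are for a continuous weight `F` and continuous charges on the fundamental cell
`cellN N L` (so that every pairing is a genuine Bochner integral); fluxes are continuous in
`hMinusOneSqW_le_of_flux` and merely square integrable against `F²` (a.e.-strongly measurable on the
cell, `∫ |J|²F² < ∞` — the natural class of flows) in `hMinusOneSqW_le_of_flux_of_integrable`; no
periodicity of `F`, `g` or `J` is needed for the inequalities (it is needed only to *produce* the
weak-divergence identity by integration by parts, which is the user's business). Proofs are
discriminant arguments, as in `hMinusOneSqW_le_ofReal_iff`.

## References

* [LyonsPeres2016] R. Lyons, Y. Peres, *Probability on Trees and Networks*, CUP 2016, §2.4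
  (Thomson's principle).
* [DoyleSnell2000] P. G. Doyle, J. L. Snell, *Random walks and electric networks*, §1.3.5.
* [KipnisLandim1999] C. Kipnis, C. Landim, *Scaling Limits of Interacting Particle Systems*,
  App. 1 §6 (6.1) (the variational formula for `‖·‖₋₁`).
-/

noncomputable section

open MeasureTheory
open scoped ENNReal BigOperators

namespace Literature.MathematicalPhysics.QuantumManyBody.BoseGas

variable {N : ℕ} {L : ℝ}

/-! ### Cauchy–Schwarz on the cell, discriminant form -/

/-- **Cauchy–Schwarz for finite families of continuous functions on the cell**:
`(∫ ∑ₐ fₐ gₐ)² ≤ (∫ ∑ₐ fₐ²) (∫ ∑ₐ gₐ²)` over `cellN N L`, for continuous `fₐ, gₐ` indexed by a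
finite type (via the discriminant of `t ↦ ∫ ∑ₐ (t gₐ − fₐ)² ≥ 0`). [folklore] -/
theorem sq_integral_sum_mul_le {ι : Type*} [Fintype ι] {f g : ι → Config N → ℝ}
    (hf : ∀ a, Continuous (f a)) (hg : ∀ a, Continuous (g a)) :
    (∫ X in cellN N L, ∑ a, f a X * g a X) ^ 2 ≤
      (∫ X in cellN N L, ∑ a, f a X ^ 2) * ∫ X in cellN N L, ∑ a, g a X ^ 2 := by
  have hfi : Integrable (fun X => ∑ a, f a X ^ 2) (volume.restrict (cellN N L)) :=
    integrableOn_cellN (continuous_finsetSum _ fun a _ => (hf a).pow 2) L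
  have hgi : Integrable (fun X => ∑ a, g a X ^ 2) (volume.restrict (cellN N L)) :=
    integrableOn_cellN (continuous_finsetSum _ fun a _ => (hg a).pow 2) L
  have hfgi : Integrable (fun X => ∑ a, f a X * g a X) (volume.restrict (cellN N L)) :=
    integrableOn_cellN (continuous_finsetSum _ fun a _ => (hf a).mul (hg a)) L
  have hpt : ∀ (t : ℝ) (X : Config N),
      0 ≤ t * t * (∑ a, g a X ^ 2) - 2 * t * (∑ a, f a X * g a X) + ∑ a, f a X ^ 2 := by
    intro t X
    have h : 0 ≤ ∑ a, (t * g a X - f a X) ^ 2 := Finset.sum_nonneg fun a _ => sq_nonneg _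
    calc (0 : ℝ) ≤ ∑ a, (t * g a X - f a X) ^ 2 := h
      _ = _ := by
        simp only [sub_sq, Finset.sum_add_distrib, Finset.sum_sub_distrib, Finset.mul_sum]
        refine congrArg₂ (· + ·) (congrArg₂ (· - ·) (Finset.sum_congr rfl fun a _ => by ring)
          (Finset.sum_congr rfl fun a _ => by ring)) rfl
  have key : ∀ t : ℝ, 0 ≤ (∫ X in cellN N L, ∑ a, g a X ^ 2) * (t * t) +
      -(2 * ∫ X in cellN N L, ∑ a, f a X * g a X) * t + ∫ X in cellN N L, ∑ a, f a X ^ 2 := by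
    intro t
    have h12 : Integrable (fun X => t * t * (∑ a, g a X ^ 2) - 2 * t * (∑ a, f a X * g a X))
        (volume.restrict (cellN N L)) := (hgi.const_mul _).sub (hfgi.const_mul _)
    have h0 : 0 ≤ ∫ X in cellN N L,
        (t * t * (∑ a, g a X ^ 2) - 2 * t * (∑ a, f a X * g a X) + ∑ a, f a X ^ 2) :=
      integral_nonneg (hpt t)
    rw [integral_add h12 hfi, integral_sub (hgi.const_mul _) (hfgi.const_mul _),
      integral_const_mul, integral_const_mul] at h0
    linarith
  have hd := discrim_le_zero key
  rw [discrim] at hd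
  nlinarith [hd]

/-! ### Thomson's principle -/

/-- **Thomson's principle (flux side) for the weighted `H₋₁` norm.** Let `F` be a continuous weight
and `J = (J_{i,k})` a continuous flux on `(ℝ³)^N` which transports the charge `g F²` weakly on the
torus of side `L`: `∫ g φ F² = −∫ (∑ᵢ ∑ₖ J_{i,k} ∂_{i,k}φ) F²` for every periodic test function `φ`.
Then `‖g‖²₋₁ ≤ ∫_{[0,L)^{3N}} |J|² F² dX` — the energy of one admissible flow bounds the effective
resistance. [cite: LyonsPeres2016, §2.4 (Thomson's principle)] -/
theorem hMinusOneSqW_le_of_flux {F g : Config N → ℝ} (J : Fin N → Fin 3 → Config N → ℝ)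
    (hF : Continuous F) (hJ : ∀ i k, Continuous (J i k))
    (hdiv : ∀ φ : Config N → ℝ, IsPeriodicTest L φ →
      ∫ X in cellN N L, g X * φ X * F X ^ 2 =
        -∫ X in cellN N L, (∑ i, ∑ k, J i k X * pderiv i k φ X) * F X ^ 2) :
    hMinusOneSqW L F g ≤ ENNReal.ofReal (∫ X in cellN N L, (∑ i, ∑ k, J i k X ^ 2) * F X ^ 2) := by
  -- the flow energy is non-negative
  have hK : 0 ≤ ∫ X in cellN N L, (∑ i, ∑ k, J i k X ^ 2) * F X ^ 2 :=
    integral_nonneg fun X =>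
      mul_nonneg (Finset.sum_nonneg fun i _ => Finset.sum_nonneg fun k _ => sq_nonneg _) (sq_nonneg _)
  rw [hMinusOneSqW_le_ofReal_iff hK]
  intro φ hφ
  rw [hdiv φ hφ, neg_sq]
  -- Cauchy–Schwarz with the families `a_{(i,k)} = J_{i,k} F`, `b_{(i,k)} = ∂_{i,k}φ · F`
  have hCS := sq_integral_sum_mul_le (L := L) (ι := Fin N × Fin 3)
    (f := fun p X => J p.1 p.2 X * F X) (g := fun p X => pderiv p.1 p.2 φ X * F X)
    (fun p => (hJ p.1 p.2).mul hF) (fun p => (continuous_pderiv hφ.contDiff p.1 p.2).mul hF)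
  have h1 : ∀ X : Config N, (∑ p : Fin N × Fin 3, J p.1 p.2 X * F X * (pderiv p.1 p.2 φ X * F X)) =
      (∑ i, ∑ k, J i k X * pderiv i k φ X) * F X ^ 2 := by
    intro X
    rw [Fintype.sum_prod_type, Finset.sum_mul]
    refine Finset.sum_congr rfl fun i _ => ?_
    rw [Finset.sum_mul]
    exact Finset.sum_congr rfl fun k _ => by ring
  have h2 : ∀ X : Config N, (∑ p : Fin N × Fin 3, (J p.1 p.2 X * F X) ^ 2) =
      (∑ i, ∑ k, J i k X ^ 2) * F X ^ 2 := by
    intro X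
    rw [Fintype.sum_prod_type, Finset.sum_mul]
    refine Finset.sum_congr rfl fun i _ => ?_
    rw [Finset.sum_mul]
    exact Finset.sum_congr rfl fun k _ => by ring
  have h3 : ∀ X : Config N, (∑ p : Fin N × Fin 3, (pderiv p.1 p.2 φ X * F X) ^ 2) =
      gradDot φ φ X * F X ^ 2 := by
    intro X
    rw [gradDot, Fintype.sum_prod_type, Finset.sum_mul]
    refine Finset.sum_congr rfl fun i _ => ?_
    rw [Finset.sum_mul]
    exact Finset.sum_congr rfl fun k _ => by ring
  simp only [h1, h2, h3] at hCS
  rw [dirichletFormW_def]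
  exact hCS

/-- **Thomson's principle, squared-pairing form**: under the hypotheses of
`hMinusOneSqW_le_of_flux`, `(∫ g φ F²)² ≤ (∫ |J|² F²) · 𝓔_F(φ, φ)` for every periodic test function
`φ` (the Kipnis–Varadhan criterion with the flow energy as constant). [cite: LyonsPeres2016, §2.4 (Thomson's principle)] -/
theorem sq_integral_le_fluxEnergy_mul_dirichletFormW {F g : Config N → ℝ}
    (J : Fin N → Fin 3 → Config N → ℝ) (hF : Continuous F) (hJ : ∀ i k, Continuous (J i k))
    (hdiv : ∀ φ : Config N → ℝ, IsPeriodicTest L φ →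
      ∫ X in cellN N L, g X * φ X * F X ^ 2 =
        -∫ X in cellN N L, (∑ i, ∑ k, J i k X * pderiv i k φ X) * F X ^ 2)
    {φ : Config N → ℝ} (hφ : IsPeriodicTest L φ) :
    (∫ X in cellN N L, g X * φ X * F X ^ 2) ^ 2 ≤
      (∫ X in cellN N L, (∑ i, ∑ k, J i k X ^ 2) * F X ^ 2) * dirichletFormW L F φ φ := by
  have hK : 0 ≤ ∫ X in cellN N L, (∑ i, ∑ k, J i k X ^ 2) * F X ^ 2 :=
    integral_nonneg fun X =>
      mul_nonneg (Finset.sum_nonneg fun i _ => Finset.sum_nonneg fun k _ => sq_nonneg _) (sq_nonneg _)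
  exact (hMinusOneSqW_le_ofReal_iff hK).1 (hMinusOneSqW_le_of_flux J hF hJ hdiv) φ hφ

/-! ### Fibre subadditivity: fibre costs add with no cross terms -/

/-- The Dirichlet form is the sum over the particles of the **fibre forms**
`𝓔_F^{(i)}(φ) = ∫ (∑ₖ (∂_{i,k}φ)²) F²` (continuous weight, `C¹` test function). [folklore] -/
theorem dirichletFormW_eq_sum_fibre {F φ : Config N → ℝ} (hF : Continuous F) (hφ : ContDiff ℝ 1 φ) :
    dirichletFormW L F φ φ = ∑ i, ∫ X in cellN N L, (∑ k, pderiv i k φ X ^ 2) * F X ^ 2 := by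
  have hint : ∀ i : Fin N, Integrable (fun X => (∑ k, pderiv i k φ X ^ 2) * F X ^ 2)
      (volume.restrict (cellN N L)) := fun i => by
    have hc : Continuous fun X => (∑ k, pderiv i k φ X ^ 2) * F X ^ 2 :=
      (continuous_finsetSum _ fun k _ => (continuous_pderiv hφ i k).pow 2).mul (hF.pow 2)
    exact integrableOn_cellN hc L
  rw [dirichletFormW_def, ← integral_finsetSum _
    (f := fun i X => (∑ k, pderiv i k φ X ^ 2) * F X ^ 2) fun i _ => hint i]
  refine integral_congr_ae (Filter.Eventually.of_forall fun X => ?_)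
  simp only [gradDot, Finset.sum_mul]
  exact Finset.sum_congr rfl fun i _ => Finset.sum_congr rfl fun k _ => by ring

/-- **Fibre subadditivity of the `H₋₁` norm.** If each charge `θᵢ` (continuous) obeys the fibre
bound `(∫ θᵢ φ F²)² ≤ cᵢ · 𝓔_F^{(i)}(φ)` against the Dirichlet form of particle `i` alone, for every
periodic test function `φ`, then `‖∑ᵢ θᵢ‖²₋₁ ≤ ∑ᵢ cᵢ` for the full form: configuration space gives
every particle its own directions, so the bath-averaged fibre resistances simply add
(Cauchy–Schwarz over the particles). [cite: LyonsPeres2016, §2.4 (Thomson's principle)] -/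
theorem hMinusOneSqW_sum_le_of_fibre {F : Config N → ℝ} (θ : Fin N → Config N → ℝ) (c : Fin N → ℝ)
    (hF : Continuous F) (hθ : ∀ i, Continuous (θ i)) (hc : ∀ i, 0 ≤ c i)
    (h : ∀ i, ∀ φ : Config N → ℝ, IsPeriodicTest L φ →
      (∫ X in cellN N L, θ i X * φ X * F X ^ 2) ^ 2 ≤
        c i * ∫ X in cellN N L, (∑ k, pderiv i k φ X ^ 2) * F X ^ 2) :
    hMinusOneSqW L F (fun X => ∑ i, θ i X) ≤ ENNReal.ofReal (∑ i, c i) := by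
  rw [hMinusOneSqW_le_ofReal_iff (Finset.sum_nonneg fun i _ => hc i)]
  intro φ hφ
  -- split the pairing over the particles
  have hsplit : ∫ X in cellN N L, (∑ i, θ i X) * φ X * F X ^ 2 =
      ∑ i, ∫ X in cellN N L, θ i X * φ X * F X ^ 2 := by
    have hint : ∀ i : Fin N, Integrable (fun X => θ i X * φ X * F X ^ 2)
        (volume.restrict (cellN N L)) := fun i => by
      have hc : Continuous fun X => θ i X * φ X * F X ^ 2 :=
        ((hθ i).mul hφ.continuous).mul (hF.pow 2)
      exact integrableOn_cellN hc L
    rw [← integral_finsetSum _ (f := fun i X => θ i X * φ X * F X ^ 2) fun i _ => hint i]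
    refine integral_congr_ae (Filter.Eventually.of_forall fun X => ?_)
    simp only [Finset.sum_mul]
  rw [hsplit, dirichletFormW_eq_sum_fibre hF hφ.contDiff]
  -- abbreviations: pairings `A i`, fibre forms `D i ≥ 0`
  set A : Fin N → ℝ := fun i => ∫ X in cellN N L, θ i X * φ X * F X ^ 2 with hA
  set D : Fin N → ℝ := fun i => ∫ X in cellN N L, (∑ k, pderiv i k φ X ^ 2) * F X ^ 2 with hD
  have hD0 : ∀ i, 0 ≤ D i := fun i =>
    integral_nonneg fun X =>
      mul_nonneg (Finset.sum_nonneg fun k _ => sq_nonneg _) (sq_nonneg _)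
  have hAi : ∀ i, |A i| ≤ Real.sqrt (c i) * Real.sqrt (D i) := by
    intro i
    rw [← Real.sqrt_mul (hc i), ← Real.sqrt_sq_eq_abs]
    exact Real.sqrt_le_sqrt (h i φ hφ)
  -- `(∑ A)² ≤ (∑ |A|)² ≤ (∑ √c √D)² ≤ (∑ c)(∑ D)`
  have hsum : |∑ i, A i| ≤ ∑ i, Real.sqrt (c i) * Real.sqrt (D i) :=
    (Finset.abs_sum_le_sum_abs _ _).trans (Finset.sum_le_sum fun i _ => hAi i)
  have hCS : (∑ i, Real.sqrt (c i) * Real.sqrt (D i)) ^ 2 ≤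
      (∑ i, Real.sqrt (c i) ^ 2) * ∑ i, Real.sqrt (D i) ^ 2 :=
    Finset.sum_mul_sq_le_sq_mul_sq _ _ _
  have hc2 : ∑ i, Real.sqrt (c i) ^ 2 = ∑ i, c i :=
    Finset.sum_congr rfl fun i _ => Real.sq_sqrt (hc i)
  have hD2 : ∑ i, Real.sqrt (D i) ^ 2 = ∑ i, D i :=
    Finset.sum_congr rfl fun i _ => Real.sq_sqrt (hD0 i)
  have h0 : 0 ≤ ∑ i, Real.sqrt (c i) * Real.sqrt (D i) :=
    Finset.sum_nonneg fun i _ => mul_nonneg (Real.sqrt_nonneg _) (Real.sqrt_nonneg _)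
  calc (∑ i, A i) ^ 2 = |∑ i, A i| ^ 2 := (sq_abs _).symm
    _ ≤ (∑ i, Real.sqrt (c i) * Real.sqrt (D i)) ^ 2 :=
        pow_le_pow_left₀ (abs_nonneg _) hsum 2
    _ ≤ (∑ i, c i) * ∑ i, D i := by rw [← hc2, ← hD2]; exact hCS

/-- **Fibre flows.** If for every particle `i` a continuous fibre flux `Jᵢ = (J_{i,k})ₖ` (directions of
particle `i` only) transports the continuous charge `θᵢ F²` weakly,
`∫ θᵢ φ F² = −∫ (∑ₖ J_{i,k} ∂_{i,k}φ) F²` for all periodic test `φ`, with energy `∫ |Jᵢ|² F² ≤ cᵢ`, then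
`‖∑ᵢ θᵢ‖²₋₁ ≤ ∑ᵢ cᵢ`: one admissible flow on `(ℝ³/Lℤ³)^N` is the concatenation of the fibre flows and
its energy is the sum of theirs. [cite: LyonsPeres2016, §2.4 (Thomson's principle)] -/
theorem hMinusOneSqW_le_of_fibreFlux {F : Config N → ℝ} (θ : Fin N → Config N → ℝ)
    (J : Fin N → Fin 3 → Config N → ℝ) (c : Fin N → ℝ)
    (hF : Continuous F) (hθ : ∀ i, Continuous (θ i)) (hJ : ∀ i k, Continuous (J i k))
    (hdiv : ∀ i, ∀ φ : Config N → ℝ, IsPeriodicTest L φ →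
      ∫ X in cellN N L, θ i X * φ X * F X ^ 2 =
        -∫ X in cellN N L, (∑ k, J i k X * pderiv i k φ X) * F X ^ 2)
    (hcost : ∀ i, ∫ X in cellN N L, (∑ k, J i k X ^ 2) * F X ^ 2 ≤ c i) :
    hMinusOneSqW L F (fun X => ∑ i, θ i X) ≤ ENNReal.ofReal (∑ i, c i) := by
  -- the concatenated flux transports the total charge
  have hdiv' : ∀ φ : Config N → ℝ, IsPeriodicTest L φ →
      ∫ X in cellN N L, (∑ i, θ i X) * φ X * F X ^ 2 =
        -∫ X in cellN N L, (∑ i, ∑ k, J i k X * pderiv i k φ X) * F X ^ 2 := by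
    intro φ hφ
    have hl : ∫ X in cellN N L, (∑ i, θ i X) * φ X * F X ^ 2 =
        ∑ i, ∫ X in cellN N L, θ i X * φ X * F X ^ 2 := by
      have hint : ∀ i : Fin N, Integrable (fun X => θ i X * φ X * F X ^ 2)
          (volume.restrict (cellN N L)) := fun i => by
        have hc : Continuous fun X => θ i X * φ X * F X ^ 2 :=
          ((hθ i).mul hφ.continuous).mul (hF.pow 2)
        exact integrableOn_cellN hc L
      rw [← integral_finsetSum _ (f := fun i X => θ i X * φ X * F X ^ 2) fun i _ => hint i]
      refine integral_congr_ae (Filter.Eventually.of_forall fun X => ?_)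
      simp only [Finset.sum_mul]
    have hr : ∫ X in cellN N L, (∑ i, ∑ k, J i k X * pderiv i k φ X) * F X ^ 2 =
        ∑ i, ∫ X in cellN N L, (∑ k, J i k X * pderiv i k φ X) * F X ^ 2 := by
      have hint : ∀ i : Fin N, Integrable (fun X => (∑ k, J i k X * pderiv i k φ X) * F X ^ 2)
          (volume.restrict (cellN N L)) := fun i => by
        have hc : Continuous fun X => (∑ k, J i k X * pderiv i k φ X) * F X ^ 2 :=
          (continuous_finsetSum _ fun k _ =>
            (hJ i k).mul (continuous_pderiv hφ.contDiff i k)).mul (hF.pow 2)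
        exact integrableOn_cellN hc L
      rw [← integral_finsetSum _ (f := fun i X => (∑ k, J i k X * pderiv i k φ X) * F X ^ 2)
        fun i _ => hint i]
      refine integral_congr_ae (Filter.Eventually.of_forall fun X => ?_)
      simp only [Finset.sum_mul]
    rw [hl, hr, ← Finset.sum_neg_distrib]
    exact Finset.sum_congr rfl fun i _ => hdiv i φ hφ
  have hK : 0 ≤ ∫ X in cellN N L, (∑ i, ∑ k, J i k X ^ 2) * F X ^ 2 :=
    integral_nonneg fun X =>
      mul_nonneg (Finset.sum_nonneg fun i _ => Finset.sum_nonneg fun k _ => sq_nonneg _) (sq_nonneg _)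
  -- total energy = sum of the fibre energies ≤ ∑ c
  have hsum : ∫ X in cellN N L, (∑ i, ∑ k, J i k X ^ 2) * F X ^ 2 ≤ ∑ i, c i := by
    have hint : ∀ i : Fin N, Integrable (fun X => (∑ k, J i k X ^ 2) * F X ^ 2)
        (volume.restrict (cellN N L)) := fun i => by
      have hc : Continuous fun X => (∑ k, J i k X ^ 2) * F X ^ 2 :=
        (continuous_finsetSum _ fun k _ => (hJ i k).pow 2).mul (hF.pow 2)
      exact integrableOn_cellN hc L
    rw [show (fun X => (∑ i, ∑ k, J i k X ^ 2) * F X ^ 2) =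
        fun X => ∑ i, (∑ k, J i k X ^ 2) * F X ^ 2 from funext fun X => Finset.sum_mul _ _ _,
      integral_finsetSum _ (f := fun i X => (∑ k, J i k X ^ 2) * F X ^ 2) fun i _ => hint i]
    exact Finset.sum_le_sum fun i _ => hcost i
  exact (hMinusOneSqW_le_of_flux J hF hJ hdiv').trans (ENNReal.ofReal_le_ofReal hsum)

/-! ### Square-integrable fluxes

Flows produced by duality arguments (minimal-energy flows, Riesz representatives) are only square
integrable against the weight, not continuous. The Cauchy–Schwarz step needs only that: the test side
`∂_{i,k}φ · F` is continuous, hence bounded on the (relatively compact) cell. -/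

/-- The fundamental cell has finite Lebesgue measure (it lies in a closed ball); local copy of
`PeriodicFeynmanKacCell.volume_cellN_ne_top` to keep the imports of this file minimal. [folklore] -/
private theorem volume_cellN_ne_top_aux (N : ℕ) (L : ℝ) : volume (cellN N L) ≠ ⊤ :=
  ((measure_mono (cellN_subset_closedBall N L)).trans_lt measure_closedBall_lt_top).ne

/-- A continuous function is a.e. bounded on the cell (restricted Lebesgue measure). [folklore] -/
theorem exists_ae_restrict_cellN_norm_le {E : Type*} [NormedAddCommGroup E] {f : Config N → E}
    (hf : Continuous f) (L : ℝ) :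
    ∃ M : ℝ, ∀ᵐ X ∂(volume.restrict (cellN N L)), ‖f X‖ ≤ M := by
  obtain ⟨M, hM⟩ := (isCompact_closedBall (0 : Config N) (2 * |L|)).exists_bound_of_continuousOn
    hf.continuousOn
  exact ⟨M, ae_restrict_of_ae_restrict_of_subset (cellN_subset_closedBall N L)
    (ae_restrict_of_forall_mem measurableSet_closedBall hM)⟩

/-- A member of a finite family that is square integrable on the cell is integrable there
(`|x| ≤ (1 + x²)/2` and the cell has finite measure). [folklore] -/
theorem integrable_of_sum_sq {ι : Type*} [Fintype ι] {f : ι → Config N → ℝ}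
    (hfm : ∀ a, AEStronglyMeasurable (f a) (volume.restrict (cellN N L)))
    (hf2 : Integrable (fun X => ∑ a, f a X ^ 2) (volume.restrict (cellN N L))) (a : ι) :
    Integrable (f a) (volume.restrict (cellN N L)) := by
  have hc : Integrable (fun _ : Config N => (1 : ℝ)) (volume.restrict (cellN N L)) :=
    integrableOn_const (volume_cellN_ne_top_aux N L)
  refine Integrable.mono' ((hc.add hf2).div_const 2) (hfm a) (Filter.Eventually.of_forall fun X => ?_)
  have h1 : f a X ^ 2 ≤ ∑ b, f b X ^ 2 :=
    Finset.single_le_sum (fun b _ => sq_nonneg (f b X)) (Finset.mem_univ a)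
  show ‖f a X‖ ≤ ((1 : ℝ) + ∑ b, f b X ^ 2) / 2
  rw [Real.norm_eq_abs]
  nlinarith [sq_nonneg (|f a X| - 1), sq_abs (f a X)]

/-- **Cauchy–Schwarz on the cell, `L² × C⁰` version**: `(∫ ∑ₐ fₐ gₐ)² ≤ (∫ ∑ₐ fₐ²)(∫ ∑ₐ gₐ²)` for
a.e.-strongly measurable `fₐ` with `∑ₐ fₐ²` integrable on the cell and continuous `gₐ`. [folklore] -/
theorem sq_integral_sum_mul_le_of_integrable {ι : Type*} [Fintype ι] {f g : ι → Config N → ℝ}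
    (hfm : ∀ a, AEStronglyMeasurable (f a) (volume.restrict (cellN N L)))
    (hf2 : Integrable (fun X => ∑ a, f a X ^ 2) (volume.restrict (cellN N L)))
    (hg : ∀ a, Continuous (g a)) :
    (∫ X in cellN N L, ∑ a, f a X * g a X) ^ 2 ≤
      (∫ X in cellN N L, ∑ a, f a X ^ 2) * ∫ X in cellN N L, ∑ a, g a X ^ 2 := by
  have hfi : Integrable (fun X => ∑ a, f a X ^ 2) (volume.restrict (cellN N L)) := hf2
  have hgi : Integrable (fun X => ∑ a, g a X ^ 2) (volume.restrict (cellN N L)) :=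
    integrableOn_cellN (continuous_finsetSum _ fun a _ => (hg a).pow 2) L
  have hfga : ∀ a, Integrable (fun X => f a X * g a X) (volume.restrict (cellN N L)) := by
    intro a
    obtain ⟨M, hM⟩ := exists_ae_restrict_cellN_norm_le (hg a) L
    exact (integrable_of_sum_sq hfm hf2 a).mul_bdd (hg a).aestronglyMeasurable hM
  have hfgi : Integrable (fun X => ∑ a, f a X * g a X) (volume.restrict (cellN N L)) :=
    integrable_finsetSum _ fun a _ => hfga a
  have hpt : ∀ (t : ℝ) (X : Config N),
      0 ≤ t * t * (∑ a, g a X ^ 2) - 2 * t * (∑ a, f a X * g a X) + ∑ a, f a X ^ 2 := by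
    intro t X
    have h : 0 ≤ ∑ a, (t * g a X - f a X) ^ 2 := Finset.sum_nonneg fun a _ => sq_nonneg _
    calc (0 : ℝ) ≤ ∑ a, (t * g a X - f a X) ^ 2 := h
      _ = _ := by
        simp only [sub_sq, Finset.sum_add_distrib, Finset.sum_sub_distrib, Finset.mul_sum]
        refine congrArg₂ (· + ·) (congrArg₂ (· - ·) (Finset.sum_congr rfl fun a _ => by ring)
          (Finset.sum_congr rfl fun a _ => by ring)) rfl
  have key : ∀ t : ℝ, 0 ≤ (∫ X in cellN N L, ∑ a, g a X ^ 2) * (t * t) +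
      -(2 * ∫ X in cellN N L, ∑ a, f a X * g a X) * t + ∫ X in cellN N L, ∑ a, f a X ^ 2 := by
    intro t
    have h12 : Integrable (fun X => t * t * (∑ a, g a X ^ 2) - 2 * t * (∑ a, f a X * g a X))
        (volume.restrict (cellN N L)) := (hgi.const_mul _).sub (hfgi.const_mul _)
    have h0 : 0 ≤ ∫ X in cellN N L,
        (t * t * (∑ a, g a X ^ 2) - 2 * t * (∑ a, f a X * g a X) + ∑ a, f a X ^ 2) :=
      integral_nonneg (hpt t)
    rw [integral_add h12 hfi, integral_sub (hgi.const_mul _) (hfgi.const_mul _),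
      integral_const_mul, integral_const_mul] at h0
    linarith
  have hd := discrim_le_zero key
  rw [discrim] at hd
  nlinarith [hd]

/-- **Thomson's principle for square-integrable fluxes.** As `hMinusOneSqW_le_of_flux`, for a flux
`J` that is only a.e.-strongly measurable on the cell with finite energy `∫ |J|² F² < ∞` (the natural
class of flows): if `∫ g φ F² = −∫ (J·∇φ) F²` for every periodic test function `φ`, then
`‖g‖²₋₁ ≤ ∫ |J|² F²`. [cite: LyonsPeres2016, §2.4 (Thomson's principle)] -/
theorem hMinusOneSqW_le_of_flux_of_integrable {F g : Config N → ℝ} (J : Fin N → Fin 3 → Config N → ℝ)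
    (hF : Continuous F)
    (hJm : ∀ i k, AEStronglyMeasurable (J i k) (volume.restrict (cellN N L)))
    (hJ2 : Integrable (fun X => (∑ i, ∑ k, J i k X ^ 2) * F X ^ 2) (volume.restrict (cellN N L)))
    (hdiv : ∀ φ : Config N → ℝ, IsPeriodicTest L φ →
      ∫ X in cellN N L, g X * φ X * F X ^ 2 =
        -∫ X in cellN N L, (∑ i, ∑ k, J i k X * pderiv i k φ X) * F X ^ 2) :
    hMinusOneSqW L F g ≤ ENNReal.ofReal (∫ X in cellN N L, (∑ i, ∑ k, J i k X ^ 2) * F X ^ 2) := by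
  have hK : 0 ≤ ∫ X in cellN N L, (∑ i, ∑ k, J i k X ^ 2) * F X ^ 2 :=
    integral_nonneg fun X =>
      mul_nonneg (Finset.sum_nonneg fun i _ => Finset.sum_nonneg fun k _ => sq_nonneg _) (sq_nonneg _)
  rw [hMinusOneSqW_le_ofReal_iff hK]
  intro φ hφ
  rw [hdiv φ hφ, neg_sq]
  have h1 : ∀ X : Config N, (∑ p : Fin N × Fin 3, J p.1 p.2 X * F X * (pderiv p.1 p.2 φ X * F X)) =
      (∑ i, ∑ k, J i k X * pderiv i k φ X) * F X ^ 2 := by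
    intro X
    rw [Fintype.sum_prod_type, Finset.sum_mul]
    refine Finset.sum_congr rfl fun i _ => ?_
    rw [Finset.sum_mul]
    exact Finset.sum_congr rfl fun k _ => by ring
  have h2 : ∀ X : Config N, (∑ p : Fin N × Fin 3, (J p.1 p.2 X * F X) ^ 2) =
      (∑ i, ∑ k, J i k X ^ 2) * F X ^ 2 := by
    intro X
    rw [Fintype.sum_prod_type, Finset.sum_mul]
    refine Finset.sum_congr rfl fun i _ => ?_
    rw [Finset.sum_mul]
    exact Finset.sum_congr rfl fun k _ => by ring
  have h3 : ∀ X : Config N, (∑ p : Fin N × Fin 3, (pderiv p.1 p.2 φ X * F X) ^ 2) =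
      gradDot φ φ X * F X ^ 2 := by
    intro X
    rw [gradDot, Fintype.sum_prod_type, Finset.sum_mul]
    refine Finset.sum_congr rfl fun i _ => ?_
    rw [Finset.sum_mul]
    exact Finset.sum_congr rfl fun k _ => by ring
  -- the family `a_{(i,k)} = J_{i,k} F` is a.e.-strongly measurable with `∑ a² = |J|²F²` integrable
  have hfm : ∀ p : Fin N × Fin 3,
      AEStronglyMeasurable (fun X => J p.1 p.2 X * F X) (volume.restrict (cellN N L)) :=
    fun p => (hJm p.1 p.2).mul hF.aestronglyMeasurable
  have hf2 : Integrable (fun X => ∑ p : Fin N × Fin 3, (J p.1 p.2 X * F X) ^ 2)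
      (volume.restrict (cellN N L)) := by
    simp only [h2]
    exact hJ2
  have hCS := sq_integral_sum_mul_le_of_integrable (L := L) (ι := Fin N × Fin 3)
    (f := fun p X => J p.1 p.2 X * F X) (g := fun p X => pderiv p.1 p.2 φ X * F X)
    hfm hf2 (fun p => (continuous_pderiv hφ.contDiff p.1 p.2).mul hF)
  simp only [h1, h2, h3] at hCS
  rw [dirichletFormW_def]
  exact hCS

end Literature.MathematicalPhysics.QuantumManyBody.BoseGas

end
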